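import Literature.NumberTheory.Automorphic.ModularLambdaRoot
import Literature.NumberTheory.Automorphic.ModularLambdaNome
import Literature.NumberTheory.Automorphic.ModularLambdaWeightZero
import HarnessLib

/-!
# The uniformizer `x = (λ/16)^{1/N}` as a function of the nome `t = e^{πiτ/N}`, and `q`-expansions at width `2N`

`Literature/NumberTheory/Automorphic/ModularLambdaRootCompetitor.lean` — PROOF-ONLY (no definition, no
named fact). F. Calegari, V. Dimitrov, Y. Tang, *The unbounded denominators conjecture*, J. Amer. Math.
Soc. 38 (2025), §3 (proof of Proposition 3.0.1) and §4.2 (proof of Lemma 4.2.2): the uniformizer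
`x = (λ/16)^{1/N}` of `ℍ` (tree: `modularLambdaRoot`, with its deck group `Λ_N` and fibres) is, as a
function of `t = q^{1/N} = e^{πiτ/N}`, the holomorphic map `t ↦ (λ(tᴺ)/16)^{1/N}` of the unit disc with
derivative `1` at `0` — "the competitor" in the conformal-radius comparison and the pull-back variable of
Theorem 2.0.1. Here we record this descent through Mathlib's `cuspFunction` at width `2N`, for `x`
and for any `2N`-periodic holomorphic function on `ℍ` bounded at `i∞` (the modular functions of `R_{2N}`
after the `λᵏ`-twist):

* (`periodic_comp_ofComplex_of_vadd`, tree `ModularLambdaWeightZero`) — `g((2N) +ᵥ τ) = g(τ)` on `ℍ` gives Mathlib's `Periodic (g ∘ ofComplex) (2N)`;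
* `cuspFunction_apply_exp` — then `cuspFunction (2N) g (e^{πiτ/N}) = g(τ)`, and
  `differentiableOn_cuspFunction_width` — the cusp function is holomorphic on the unit disc;
* `modularLambdaRoot_vadd` — `x((2N) +ᵥ τ) = x(τ)`; `isZeroAtImInfty_modularLambdaRoot` — `x → 0` at `i∞`;
* ★ `cuspFunction_modularLambdaRoot_spec` — `Ψ := cuspFunction (2N) x` is holomorphic on the disc,
  `Ψ(e^{πiτ/N}) = x(τ)`, `Ψ(0) = 0`, `Ψ′(0) = 1`, `Ψ(z)ᴺ = Λ₁₆(zᴺ)`; hence `16^{1/N} Ψ` maps the disc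
  into `ℂ ∖ μ_N` and vanishes only at `0` (`mapsTo_rpow_mul_cuspFunction_modularLambdaRoot`,
  `eq_zero_of_cuspFunction_modularLambdaRoot_eq_zero`) — exactly the data «`Ψ`» of
  `Literature.Analysis.Complex.exists_taylor_subst_eq_of_continuation` and «`F`» of
  `Literature.Analysis.Complex.exists_holomorphic_extension_of_local_root_systems`, with the extra
  relation `F(e^{πiτ/N}) = 16^{1/N} x(τ)` that ties the disc to the uniformizer.

## References
* [CalegariDimitrovTang2025] F. Calegari, V. Dimitrov, Y. Tang, J. Amer. Math. Soc. 38 (2025), §3 proof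
  of Proposition 3.0.1 (display (xt)), §4.2 proof of Lemma 4.2.2.
-/

noncomputable section

open Complex Real Filter Topology Function Metric Set
open UpperHalfPlane hiding I
open scoped Real Topology Manifold MatrixGroups

namespace Literature.NumberTheory.Automorphic

namespace ModularLambda

open ModularGroup

/-! ### §1 `q`-expansions at width `2N` -/

/-- `𝕢_{2N}(τ) = e^{πiτ/N}` (CDT's `t = q^{1/N}`). [cite: CalegariDimitrovTang2025, §3 proof of Prop. 3.0.1] -/
theorem qParam_two_mul_eq (N : ℕ) (hN : N ≠ 0) (τ : ℂ) :
    Periodic.qParam ((2 * N : ℕ) : ℝ) τ = Complex.exp (π * Complex.I * τ / N) := by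
  rw [Periodic.qParam]
  congr 1
  push_cast
  have : (N : ℂ) ≠ 0 := by exact_mod_cast hN
  field_simp

/-- **`q`-expansion at width `2N`**: for `g : ℍ → ℂ` with `g(τ + 2N) = g(τ)`,
`cuspFunction (2N) g (e^{πiτ/N}) = g(τ)`. [cite: CalegariDimitrovTang2025, §4.1 (cusp width)] -/
theorem cuspFunction_apply_exp {g : ℍ → ℂ} {N : ℕ} (hN : N ≠ 0)
    (hp : ∀ τ : ℍ, g ((((2 * N : ℕ) : ℝ)) +ᵥ τ) = g τ) (τ : ℍ) :
    cuspFunction ((2 * N : ℕ) : ℝ) g (Complex.exp (π * Complex.I * τ / N)) = g τ := by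
  rw [← qParam_two_mul_eq N hN]
  exact eq_cuspFunction τ (by exact_mod_cast (by omega : 2 * N ≠ 0))
    (periodic_comp_ofComplex_of_vadd hp)

/-- The cusp function at width `2N` of a holomorphic `2N`-periodic function bounded at `i∞` is
holomorphic on the unit disc (Mathlib). [cite: CalegariDimitrovTang2025, §4.2 proof of Lemma 4.2.2] -/
theorem differentiableOn_cuspFunction_width {g : ℍ → ℂ} {N : ℕ} (hN : N ≠ 0)
    (hp : ∀ τ : ℍ, g ((((2 * N : ℕ) : ℝ)) +ᵥ τ) = g τ) (hg : MDiff g) (hbdd : IsBoundedAtImInfty g) :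
    DifferentiableOn ℂ (cuspFunction ((2 * N : ℕ) : ℝ) g) (ball 0 1) :=
  differentiableOn_cuspFunction_ball (by exact_mod_cast (by omega : 0 < 2 * N))
    (periodic_comp_ofComplex_of_vadd hp) hg hbdd

/-- `t = e^{πiτ/N}` lies in the unit disc for `τ ∈ ℍ`. [cite: CalegariDimitrovTang2025, §3 proof of Prop. 3.0.1] -/
theorem exp_mem_ball_of_im_pos (N : ℕ) (hN : N ≠ 0) (τ : ℍ) :
    Complex.exp (π * Complex.I * τ / N) ∈ ball (0 : ℂ) 1 := by
  rw [mem_ball_zero_iff, Complex.norm_exp]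
  have hN' : (0 : ℝ) < N := by exact_mod_cast Nat.pos_of_ne_zero hN
  have e : (π : ℂ) * Complex.I * (τ : ℂ) / N = ((π / N : ℝ) : ℂ) * (Complex.I * (τ : ℂ)) := by
    push_cast
    have : (N : ℂ) ≠ 0 := by exact_mod_cast hN
    field_simp
  rw [e, Complex.re_ofReal_mul, Complex.I_mul_re, UpperHalfPlane.coe_im, Real.exp_lt_one_iff]
  have h1 : 0 < π / N * τ.im := mul_pos (div_pos Real.pi_pos hN') τ.im_pos
  linarith

/-- Every point of the punctured unit disc is `t = e^{πiτ/N}` for some `τ ∈ ℍ`.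
[cite: CalegariDimitrovTang2025, §3 proof of Prop. 3.0.1] -/
theorem exists_exp_eq_of_mem_ball {N : ℕ} (hN : N ≠ 0) {z : ℂ} (hz : ‖z‖ < 1) (hz0 : z ≠ 0) :
    ∃ τ : ℍ, Complex.exp (π * Complex.I * τ / N) = z := by
  have h2N : ((2 * N : ℕ) : ℝ) ≠ 0 := by exact_mod_cast (by omega : 2 * N ≠ 0)
  have h2N' : (0 : ℝ) < ((2 * N : ℕ) : ℝ) := by exact_mod_cast (by omega : 0 < 2 * N)
  refine ⟨⟨Periodic.invQParam ((2 * N : ℕ) : ℝ) z, Periodic.im_invQParam_pos_of_norm_lt_one h2N' hz hz0⟩, ?_⟩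
  rw [← qParam_two_mul_eq N hN]
  exact Periodic.qParam_right_inv h2N hz0

/-! ### §2 The uniformizer at the cusp -/

/-- `x(τ + 2N) = x(τ)`: the cusp `i∞` of the deck group `Λ_N` has width `2N`.
[cite: CalegariDimitrovTang2025, §3, proof of Proposition 3.0.1] -/
theorem modularLambdaRoot_vadd {N : ℕ} (hN : N ≠ 0) (τ : ℍ) :
    modularLambdaRoot N ((((2 * N : ℕ) : ℝ)) +ᵥ τ) = modularLambdaRoot N τ := by
  have h := modularLambdaRoot_T_sq_pow_smul hN N τ
  rw [exp_two_pi_I_div_pow, one_mul, ← pow_mul, ← zpow_natCast, modular_T_zpow_smul] at h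
  have e : ((((2 * N : ℕ) : ℤ) : ℝ)) = ((2 * N : ℕ) : ℝ) := by push_cast; ring
  rw [e] at h
  exact h

/-- `x → 0` at `i∞` (`x e^{−πiτ/N} → 1` and `e^{πiτ/N} → 0`). [cite: CalegariDimitrovTang2025, §3 (xt)] -/
theorem isZeroAtImInfty_modularLambdaRoot {N : ℕ} (hN : N ≠ 0) :
    IsZeroAtImInfty (modularLambdaRoot N) := by
  have h1 := tendsto_modularLambdaRoot_mul_exp hN
  have h2 : Tendsto (fun τ : ℍ ↦ Complex.exp (π * Complex.I * τ / N)) atImInfty (𝓝 0) := by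
    have h := qParam_tendsto_atImInfty (h := ((2 * N : ℕ) : ℝ)) (by exact_mod_cast (by omega : 0 < 2 * N))
    refine h.congr fun τ ↦ ?_
    exact qParam_two_mul_eq N hN τ
  have h3 := h1.mul h2
  rw [one_mul] at h3
  refine h3.congr fun τ ↦ ?_
  rw [mul_assoc, ← Complex.exp_add, neg_add_cancel, Complex.exp_zero, mul_one]

/-- ★ **The uniformizer as a function of the nome.** For `N ≥ 1` let `Ψ := cuspFunction (2N) x`
(`x = modularLambdaRoot N`). Then `Ψ` is holomorphic on the unit disc, `Ψ(e^{πiτ/N}) = x(τ)` for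
`τ ∈ ℍ`, `Ψ(0) = 0`, `Ψ′(0) = 1`, and `Ψ(z)ᴺ = Λ₁₆(zᴺ)` (`Λ₁₆ = cuspFunction 2 (λ/16)`) on the disc.
[cite: CalegariDimitrovTang2025, §3, proof of Proposition 3.0.1, display (xt)] -/
theorem cuspFunction_modularLambdaRoot_spec {N : ℕ} (hN : N ≠ 0) :
    DifferentiableOn ℂ (cuspFunction ((2 * N : ℕ) : ℝ) (modularLambdaRoot N)) (ball 0 1) ∧
    (∀ τ : ℍ, cuspFunction ((2 * N : ℕ) : ℝ) (modularLambdaRoot N) (Complex.exp (π * Complex.I * τ / N)) =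
      modularLambdaRoot N τ) ∧
    cuspFunction ((2 * N : ℕ) : ℝ) (modularLambdaRoot N) 0 = 0 ∧
    deriv (cuspFunction ((2 * N : ℕ) : ℝ) (modularLambdaRoot N)) 0 = 1 ∧
    ∀ z ∈ ball (0 : ℂ) 1, cuspFunction ((2 * N : ℕ) : ℝ) (modularLambdaRoot N) z ^ N =
      (cuspFunction 2 (fun τ : ℍ ↦ modularLambda τ / 16)) (z ^ N) := by
  set Ψ := cuspFunction ((2 * N : ℕ) : ℝ) (modularLambdaRoot N) with hΨ
  have h2Npos : (0 : ℝ) < ((2 * N : ℕ) : ℝ) := by exact_mod_cast (by omega : 0 < 2 * N)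
  have hper : ∀ τ : ℍ, modularLambdaRoot N ((((2 * N : ℕ) : ℝ)) +ᵥ τ) = modularLambdaRoot N τ :=
    modularLambdaRoot_vadd hN
  have hmd : MDiff (modularLambdaRoot N) := mdifferentiable_modularLambdaRoot N
  have hzero := isZeroAtImInfty_modularLambdaRoot hN
  have hbdd : IsBoundedAtImInfty (modularLambdaRoot N) := hzero.isBoundedAtImInfty
  have hd : DifferentiableOn ℂ Ψ (ball 0 1) := differentiableOn_cuspFunction_width hN hper hmd hbdd
  have happ : ∀ τ : ℍ, Ψ (Complex.exp (π * Complex.I * τ / N)) = modularLambdaRoot N τ :=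
    fun τ ↦ cuspFunction_apply_exp hN hper τ
  have hΨ0 : Ψ 0 = 0 := by
    rw [hΨ, cuspFunction_apply_zero h2Npos
      (analyticAt_cuspFunction_zero h2Npos (periodic_comp_ofComplex_of_vadd hper) hmd hbdd)
      (periodic_comp_ofComplex_of_vadd hper)]
    exact hzero.valueAtInfty_eq_zero
  -- the derivative at `0` along `t = e^{πiτ/N}`, `τ → i∞`
  have hderiv : deriv Ψ 0 = 1 := by
    have hdiff : DifferentiableAt ℂ Ψ 0 := hd.differentiableAt (ball_mem_nhds _ one_pos)
    have hslope : Tendsto (fun q ↦ q⁻¹ • (Ψ q - Ψ 0)) (𝓝[≠] 0) (𝓝 (deriv Ψ 0)) := by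
      have h := hdiff.hasDerivAt.tendsto_slope_zero
      simpa using h
    set e : ℍ → ℂ := fun τ ↦ Complex.exp (π * Complex.I * τ / N) with he
    have he0 : Tendsto e atImInfty (𝓝[≠] 0) := by
      have h := qParam_tendsto_atImInfty h2Npos
      refine tendsto_nhdsWithin_iff.mpr ⟨h.congr fun τ ↦ qParam_two_mul_eq N hN τ, ?_⟩
      exact Eventually.of_forall fun τ ↦ Complex.exp_ne_zero _
    have hcomp := hslope.comp he0
    have hlim1 : Tendsto (fun τ : ℍ ↦ (e τ)⁻¹ • (Ψ (e τ) - Ψ 0)) atImInfty (𝓝 1) := by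
      refine (tendsto_modularLambdaRoot_mul_exp hN).congr fun τ ↦ ?_
      rw [hΨ0, sub_zero, happ, smul_eq_mul, he, ← Complex.exp_neg, mul_comm]
    exact tendsto_nhds_unique hcomp hlim1
  refine ⟨hd, happ, hΨ0, hderiv, fun z hz ↦ ?_⟩
  rcases eq_or_ne z 0 with rfl | hz0
  · rw [hΨ0, zero_pow hN, cuspFunction_modularLambda_zero]
  · obtain ⟨τ, hτ⟩ := exists_exp_eq_of_mem_ball hN (mem_ball_zero_iff.mp hz) hz0
    rw [← hτ, happ τ, modularLambdaRoot_pow hN, ← Complex.exp_nat_mul,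
      mul_div_cancel₀ _ (by exact_mod_cast hN : (N : ℂ) ≠ 0), cuspFunction_modularLambda_exp τ.im_pos]

/-- `16^{1/N} Ψ` maps the unit disc into `ℂ ∖ μ_N` (`λ ≠ 16` on the nome disc:
`Λ₁₆ ≠ 1/16`). [cite: CalegariDimitrovTang2025, §3, proof of Proposition 3.0.1] -/
theorem mapsTo_rpow_mul_cuspFunction_modularLambdaRoot {N : ℕ} (hN : N ≠ 0) :
    MapsTo (fun t ↦ (((16 : ℝ) ^ ((N : ℝ)⁻¹) : ℝ) : ℂ) * cuspFunction ((2 * N : ℕ) : ℝ) (modularLambdaRoot N) t)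
      (ball (0 : ℂ) 1) {z : ℂ | z ^ N ≠ 1} := by
  obtain ⟨-, -, -, -, hpow⟩ := cuspFunction_modularLambdaRoot_spec hN
  have hN0 : (N : ℝ) ≠ 0 := by exact_mod_cast hN
  have hrN : ((16 : ℝ) ^ ((N : ℝ)⁻¹)) ^ N = 16 := by
    rw [← Real.rpow_natCast, ← Real.rpow_mul (by norm_num), inv_mul_cancel₀ hN0, Real.rpow_one]
  have hcN : ((((16 : ℝ) ^ ((N : ℝ)⁻¹) : ℝ) : ℂ)) ^ N = 16 := by exact_mod_cast hrN
  intro z hz h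
  simp only [mul_pow, hcN, hpow z hz] at h
  have hzN : ‖z ^ N‖ < 1 := by
    rw [norm_pow]; exact pow_lt_one₀ (norm_nonneg _) (mem_ball_zero_iff.mp hz) hN
  exact cuspFunction_modularLambda_ne_one_div_sixteen hzN (by linear_combination (1 / 16 : ℂ) * h)

/-- `Ψ(t) = 0` only for `t = 0` (`λ ≠ 0` on `ℍ`). [cite: CalegariDimitrovTang2025, §3 (xt)] -/
theorem eq_zero_of_cuspFunction_modularLambdaRoot_eq_zero {N : ℕ} (hN : N ≠ 0) {t : ℂ}
    (ht : t ∈ ball (0 : ℂ) 1) (h0 : cuspFunction ((2 * N : ℕ) : ℝ) (modularLambdaRoot N) t = 0) : t = 0 := by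
  obtain ⟨-, -, -, -, hpow⟩ := cuspFunction_modularLambdaRoot_spec hN
  by_contra ht0
  have htN : t ^ N ≠ 0 := pow_ne_zero _ ht0
  have htNball : ‖t ^ N‖ < 1 := by
    rw [norm_pow]; exact pow_lt_one₀ (norm_nonneg _) (mem_ball_zero_iff.mp ht) hN
  have h1 := hpow t ht
  rw [h0, zero_pow hN] at h1
  exact cuspFunction_modularLambda_ne_zero htNball htN h1.symm

end ModularLambda

end Literature.NumberTheory.Automorphic

end
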